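import Summits.HodgeConjecture.HodgeConjecture.Theorems.CyclicUnitaryPowersFiveFacts
import Summits.HodgeConjecture.HodgeConjecture.Theorems.CyclicUnitaryPowersDeckHodgeOfGriffiths
import Literature.AlgebraicGeometry.HodgeTheory.UnitaryReflectionGroupZariskiDenseHolds

/-!
# K1 `VeryGeneralDeckCommutatorsInHg` of route `CyclicUnitaryPowers` modulo THREE cited facts: the
# Carlson–Toledo family, the Cattani–Deligne–Kaplan cover, and Griffiths' residue kernel — Carlson–Toledo's
# density theorem 7.1 is now a THEOREM

Crux K1 (`stmt-HodgeConjecture-19544`). The tree held K1 modulo FIVE cited facts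
(`CyclicUnitaryPowersFiveFacts.veryGeneralDeckCommutatorsInHg_of_five_facts`, prover-Ax: the Carlson–Toledo
family, its invariant line `carlsonToledo1999_finrank_eigenspace_deck_one` and eigen-Hodge numbers
`carlsonToledo1999_finrank_eigenspace_inf_hodgePiece`, Carlson–Toledo's density theorem
`carlsonToledo1999_unitaryReflection_zariskiDense` (§7 Thm `udensitytheo`), and the Cattani–Deligne–Kaplan
cover), and the two Hodge-number facts were themselves theorems modulo Griffiths' residue-kernel package
`Griffiths1969_residueKernel_eq_jacobianIdeal` (`CyclicUnitaryPowersDeckHodgeOfGriffiths`, prover-Bx g5). This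
file feeds in the DISCHARGE of the density theorem —
`Literature.AlgebraicGeometry.HodgeTheory.carlsonToledo1999_unitaryReflection_zariskiDense_holds`
(`UnitaryReflectionGroupZariskiDenseHolds`: an algebraic proof through the Lie algebra of the Zariski closure,
files `UnitaryReflectionLie{Projector,Irreducible,Core,Closure}`, `UnitaryReflectionRealTransfer`):

* `veryGeneralDeckCommutatorsInHg_of_four_facts` — K1 from `nonempty_carlsonToledoFamily`, the two
  Carlson–Toledo Hodge-number facts and `cmsp_nonHodgeGenericPoints_countable_algebraic_cover`;
* `veryGeneralDeckCommutatorsInHg_of_three_facts` — **K1 from exactly THREE cited facts**: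
  `nonempty_carlsonToledoFamily` (CT §§2–3, 6–7: the universal family of `p`-cyclic surfaces with its
  Picard–Lefschetz reflection system), `cmsp_nonHodgeGenericPoints_countable_algebraic_cover`
  (Cattani–Deligne–Kaplan 1995) and `Griffiths1969_residueKernel_eq_jacobianIdeal` (Griffiths 1969 / Voisin
  II 6.10–6.12, SHARED with route `SignSymmetricPowers`);
* the rung leaf `CyclicSurfacePowersHodge` (`stmt-HodgeConjecture-19543`) modulo the same four / three.

Honest framing: K1 and the leaf remain CONDITIONAL on three deep geometric facts; the density theorem, Katz
GKR, Deligne/CMSP 15.3.7, the unitary torus lemma and the FFT steps are all PROVED in the tree; nothing here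
says HC ∕ HC_AV is proved; rung F-H1 not moved.
-/

noncomputable section


set_option linter.dupNamespace false

namespace Summit.HodgeConjecture.HodgeConjecture.Theorems.CyclicUnitaryPowersThreeFacts

open Literature.AlgebraicGeometry.Motives Literature.AlgebraicGeometry.HodgeTheory

/-- **K1 `VeryGeneralDeckCommutatorsInHg` from FOUR cited facts** (the Carlson–Toledo family, its invariant line
and eigen-Hodge numbers, the Cattani–Deligne–Kaplan cover): `veryGeneralDeckCommutatorsInHg_of_five_facts` with
Carlson–Toledo's density theorem 7.1 supplied by the tree THEOREM
`carlsonToledo1999_unitaryReflection_zariskiDense_holds`. CONDITIONAL.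
[cite: CarlsonToledo1999, §2 and §7 Theorem udensitytheo] [cite: CarlsonMullerStachPeters2017, Lemma–Definition 15.3.7] -/
theorem veryGeneralDeckCommutatorsInHg_of_four_facts
    (hCT : nonempty_carlsonToledoFamily)
    (hCT1 : carlsonToledo1999_finrank_eigenspace_deck_one)
    (hCT2 : carlsonToledo1999_finrank_eigenspace_inf_hodgePiece)
    (hCDK : cmsp_nonHodgeGenericPoints_countable_algebraic_cover) :
    Summit.HodgeConjecture.HodgeConjecture.Theses.CyclicUnitaryPowers.VeryGeneralDeckCommutatorsInHg :=
  CyclicUnitaryPowersFiveFacts.veryGeneralDeckCommutatorsInHg_of_five_facts @hCT @hCT1 @hCT2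
    carlsonToledo1999_unitaryReflection_zariskiDense_holds @hCDK

/-- **K1 `VeryGeneralDeckCommutatorsInHg` from THREE cited facts**: the Carlson–Toledo family
(`nonempty_carlsonToledoFamily`), the Cattani–Deligne–Kaplan cover
(`cmsp_nonHodgeGenericPoints_countable_algebraic_cover`) and Griffiths' residue kernel
(`Griffiths1969_residueKernel_eq_jacobianIdeal`) — the two Carlson–Toledo Hodge-number facts being theorems
modulo the last (`CyclicUnitaryPowersDeckHodgeOfGriffiths`) and the density theorem 7.1 a theorem outright.
CONDITIONAL; nothing here says HC ∕ HC_AV is proved.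
[cite: CarlsonToledo1999, §2, §5 and §7 Theorem udensitytheo]
[cite: VoisinHodgeII2003, §6.1.3 Thm. 6.10 and Cor. 6.12] -/
theorem veryGeneralDeckCommutatorsInHg_of_three_facts
    (hCT : nonempty_carlsonToledoFamily)
    (hCDK : cmsp_nonHodgeGenericPoints_countable_algebraic_cover)
    (hG : Griffiths1969_residueKernel_eq_jacobianIdeal) :
    Summit.HodgeConjecture.HodgeConjecture.Theses.CyclicUnitaryPowers.VeryGeneralDeckCommutatorsInHg :=
  veryGeneralDeckCommutatorsInHg_of_four_facts @hCT
    (CyclicUnitaryPowersDeckHodgeOfGriffiths.carlsonToledo1999_finrank_eigenspace_deck_one_of_residueKernel hG)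
    (CyclicUnitaryPowersDeckHodgeOfGriffiths.carlsonToledo1999_finrank_eigenspace_inf_hodgePiece_of_residueKernel
      hG) @hCDK

/-- **The rung leaf `CyclicSurfacePowersHodge` (stmt-HodgeConjecture-19543) modulo the same FOUR facts.**
CONDITIONAL; rung F-H1 not moved. [cite: CarlsonToledo1999, §2 and §7 Theorem udensitytheo] -/
theorem cyclicSurfacePowersHodge_of_four_facts
    (hCT : nonempty_carlsonToledoFamily)
    (hCT1 : carlsonToledo1999_finrank_eigenspace_deck_one)
    (hCT2 : carlsonToledo1999_finrank_eigenspace_inf_hodgePiece)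
    (hCDK : cmsp_nonHodgeGenericPoints_countable_algebraic_cover) :
    Summit.HodgeConjecture.HodgeConjecture.Theses.CyclicUnitaryPowers.CyclicSurfacePowersHodge :=
  CyclicUnitaryPowersCyclicSurfacePowersHodge.cyclicSurfacePowersHodge_of_veryGeneralDeckCommutatorsInHg
    (veryGeneralDeckCommutatorsInHg_of_four_facts @hCT @hCT1 @hCT2 @hCDK)

/-- **The rung leaf `CyclicSurfacePowersHodge` (stmt-HodgeConjecture-19543) modulo THREE cited facts** (the
Carlson–Toledo family, Cattani–Deligne–Kaplan, Griffiths' residue kernel). CONDITIONAL; rung F-H1 not moved;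
nothing here says HC ∕ HC_AV is proved. [cite: CarlsonToledo1999, §2, §5 and §7 Theorem udensitytheo]
[cite: VoisinHodgeII2003, §6.1.3 Thm. 6.10 and Cor. 6.12] -/
theorem cyclicSurfacePowersHodge_of_three_facts
    (hCT : nonempty_carlsonToledoFamily)
    (hCDK : cmsp_nonHodgeGenericPoints_countable_algebraic_cover)
    (hG : Griffiths1969_residueKernel_eq_jacobianIdeal) :
    Summit.HodgeConjecture.HodgeConjecture.Theses.CyclicUnitaryPowers.CyclicSurfacePowersHodge :=
  CyclicUnitaryPowersCyclicSurfacePowersHodge.cyclicSurfacePowersHodge_of_veryGeneralDeckCommutatorsInHg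
    (veryGeneralDeckCommutatorsInHg_of_three_facts @hCT @hCDK @hG)

end Summit.HodgeConjecture.HodgeConjecture.Theorems.CyclicUnitaryPowersThreeFacts

end
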